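import Summits.QuantumFields.BalabanUV.Beta.GAN24.FineReadoutCauchyMatched
import Summits.QuantumFields.BalabanUV.Beta.GAN24.KFibClosedBridge

/-!
# `BalabanUV.Beta.GAN24.FineReadoutCauchyMatchedColumn` — binder row G-an2-4 / (CONV-C), S-slot located remainder «E3SupRate», located leaf «(N1-Cauchy)»,
# PART A «matched sub-alias», bridge for the holder's PART S: AT REAL MOMENTUM THE MINIMISER COLUMN IS THE PLANE-WAVE SYNTHESIS OF T00's
# CONCRETE AMPLITUDES `Ahat N (ofRealVec q) 0 (eVec l)` — the `hexp`/`hexp′` hypotheses of leaf-17's `FineReadoutCauchyFold.diffSym_eq_sum_fold`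

NOT IN PRINT; OUR PROOF ATTEMPT (of the road; THIS file is [folklore] bookkeeping: leaf-06's `AliasFibreBridge.boxData_eq_synth_Ahat` + leaf-05's
`FibInvClosedForm.fibreFun_fibInvCol`/`srcEL_single_inr`/`single_inr_Q` BY NAME on the multiplier unit column; no estimate, no cited fact, no wall
binder, no `def`, no `def … : Prop`).  HONEST FRAMING (cell contract, verbatim): «discharging `BetaPertH` makes Bałaban's UV stability UNCONDITIONAL — a
real constructive-QFT result; it is NOT the continuum limit and NOT the Clay problem.»  HONEST DEPENDENCY (verbatim): «continuum YM on T⁴ ⇐ BetaPertH ∧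
nine spine estimates (0/9 proved); BetaPertH ⇐ (D1) ∧ (D4) ∧ CAP+tail; G-an2-4 gates asym, D1 and NE2/3/4.»  Discharges NOTHING of (hS, hSall) /
«E3SupRate» / «(N1-Cauchy)»; NOT `BetaPertH`, NOT continuum, NOT Clay.

## What is proved (generic `d`, block side `N ≥ 1`, REAL `q ∈ BZ (d+1) ∖ {0}`)
* **`fibInv_inl_inr_eq_sum_Ahat`**: `fibInv N (inl (κ, ζ)) (inr (inr l)) (ofRealVec q) = Σ_m Ahat N (ofRealVec q) 0 (eVec l) m κ · pw (kFine (ofRealVec q) m) (repZ ζ)`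
  — EVERY alias class explicit (the zero alias included; no `∃ c`, no `det ≠ 0` hypothesis: real momentum).
* **`natPow_mul_fibInv_eq_sum_ampT`**: the normalised form `N^{d+2}·fibInv … = Σ_m ampT N q l m κ · pw (kFine (ofRealVec q) m) (repZ ζ)` with PART A's
  `FineReadoutCauchyMatched.ampT` (so `diffSym_eq_sum_fold`'s `Amp`, `Amp′` are `ampT N q l`, `ampT N′ q l` up to the displayed powers).
Unit `b2b-balaban-gan24-formalise-leaf-16` (G-an2-4 formalisation swarm, leaf prover 16, gen 9), 2026-08-20.
-/

noncomputable section

open Complex Finset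
open scoped BigOperators

namespace Summit.QuantumFields.BalabanUV.Beta.GAN24.FineReadoutCauchyMatchedColumn

open Literature.Probability.LatticeModels (TorusSite)
open Literature.MathematicalPhysics.QuantumFieldTheory.LatticeForm (repZ)
open Literature.MathematicalPhysics.QuantumFieldTheory.Balaban1983to89.B4Strip (ofRealVec)
open Literature.MathematicalPhysics.QuantumFieldTheory.Balaban1983to89.B4ContourShift (BZ)
open Literature.MathematicalPhysics.QuantumFieldTheory.Balaban1983to89.Beta.BlochFibreMatrix (Idx)
open Summit.QuantumFields.BalabanUV.Beta.GAN24.FibreSymbols (pw)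
open Summit.QuantumFields.BalabanUV.Beta.GAN24.FibreDFT (kFine)
open Summit.QuantumFields.BalabanUV.Beta.GAN24.AliasObjects (Ahat eVec)
open Summit.QuantumFields.BalabanUV.Beta.GAN24.CombesThomasFibre (fibInv)
open Summit.QuantumFields.BalabanUV.Beta.GAN24.FineReadoutCauchyMatched (ampT)

variable {d N : ℕ} [NeZero N] {q : Fin (d + 1) → ℝ}

/-- [folklore] **THE MINIMISER COLUMN AT REAL MOMENTUM, ALIAS BY ALIAS, IN T00's CONCRETE CURRENCY**: for `q ∈ BZ ∖ {0}`,
`(F_N(p)⁻¹)_{(κ,ζ),(Q,l)} = Σ_m Ahat N p 0 (eVec l) m κ · pw (k_m) (repZ ζ)`, `p = ofRealVec q`. -/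
theorem fibInv_inl_inr_eq_sum_Ahat (hq : q ∈ BZ (d + 1)) (hq0 : q ≠ 0) (l κ : Fin (d + 1)) (ζ : TorusSite (d + 1) N) :
    fibInv N (Sum.inl (κ, ζ)) (Sum.inr (Sum.inr l)) (ofRealVec q)
      = ∑ m : TorusSite (d + 1) N, Ahat N (ofRealVec q) 0 (eVec l) m κ * pw (kFine (ofRealVec q) m) (repZ ζ) := by
  have hv := FibInvClosedForm.fibreFun_fibInvCol (N := N) q (Sum.inr (Sum.inr l))
  have hr : ∀ z : TorusSite (d + 1) N,
      Pi.single (M := fun _ : Idx (d + 1) N => ℂ) (Sum.inr (Sum.inr l)) (1 : ℂ) (Sum.inr (Sum.inl z)) = 0 := fun z => by simp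
  have h := AliasFibreBridge.boxData_eq_synth_Ahat hq hq0 hv hr κ ζ
  rw [FibInvClosedForm.srcEL_single_inr] at h
  have he : (fun κ => Pi.single (M := fun _ : Idx (d + 1) N => ℂ) (Sum.inr (Sum.inr l)) (1 : ℂ) (Sum.inr (Sum.inr κ))) = eVec l := by
    funext κ'; rw [FibInvClosedForm.single_inr_Q]; rfl
  rw [he] at h
  exact h

/-- [folklore] **NORMALISED FORM**: `N^{d+2}·(F_N(p)⁻¹)_{(κ,ζ),(Q,l)} = Σ_m ampT N q l m κ · pw (k_m) (repZ ζ)` — PART A's amplitudes `ampT = N^{d+2}·Ahat` are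
the `Amp` of leaf-17's `FineReadoutCauchyFold.diffSym_eq_sum_fold` after the prefactor is distributed. -/
theorem natPow_mul_fibInv_eq_sum_ampT (hq : q ∈ BZ (d + 1)) (hq0 : q ≠ 0) (l κ : Fin (d + 1)) (ζ : TorusSite (d + 1) N) :
    (N : ℂ) ^ (d + 2) * fibInv N (Sum.inl (κ, ζ)) (Sum.inr (Sum.inr l)) (ofRealVec q)
      = ∑ m : TorusSite (d + 1) N, ampT N q l m κ * pw (kFine (ofRealVec q) m) (repZ ζ) := by
  rw [fibInv_inl_inr_eq_sum_Ahat hq hq0, Finset.mul_sum]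
  exact Finset.sum_congr rfl fun m _ => by unfold FineReadoutCauchyMatched.ampT; ring

end Summit.QuantumFields.BalabanUV.Beta.GAN24.FineReadoutCauchyMatchedColumn

end
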